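import Summits.KontsevichZagierPeriods.KontsevichZagierPeriods.Theses.TerasomaMultiplication
import Literature.NumberTheory.Transcendental.KZGroundingRelations
import Literature.NumberTheory.Transcendental.KZSemialgebraicComplex
import Literature.NumberTheory.Transcendental.EllIterRep
import Literature.NumberTheory.Transcendental.SemialgebraicLineDeriv
import Summits.KontsevichZagierPeriods.KontsevichZagierPeriods.Theorems.HermiteRigidityGenusTwoCycleTransferPushforwardDimOne
import Summits.KontsevichZagierPeriods.KontsevichZagierPeriods.Theorems.DasGapTwelve.Negative.LoadBearing

/-!
# `DasGapTwelve` (stmt-KontsevichZagierPeriods-13215), line `picard-involution-quotient`: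
# stub F — the fold by the real involution of the Picard curve

Stub `stub_involutionFold` of the crux `DasGapTwelve` (route `TerasomaMultiplication`). On the
quartic `v⁴ = t − t⁴` (the Picard curve) the Möbius map `m(t) = (1 − t)/(1 + 2t)` is an
involution of the real arc `(0,1)` fixing `t⋆ = (√3 − 1)/2`, exchanging `(0,t⋆)` and `(t⋆,1)`,
with `m − m⁴ = 9(t − t⁴)/(1+2t)⁴`, `m′ = −3/(1+2t)²` and `m(t) − t⋆ = −√3(t − t⋆)/(1+2t)`.
Consequently the form `κ = (t − t⋆)(t − t⁴)^(−3/4) dt` is `m`-anti-invariant: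
`κ(m t)|m′(t)| = −κ(t)`. In the Kontsevich–Zagier calculus this makes
`[(0,1), √3(t − t⋆)(t − t⁴)^(−3/4)]` a relation: split the domain at `t⋆` (rule 1a, the point
`{t⋆}` being null), push the left cell forward along `m` (rule 2, the generic one-dimensional
push-forward `stub_pushforwardDimOne`) — its image is the right cell and its integrand is the
negative of the right cell's — and cancel (rule 1b). Since
`√3(t + (1+√3)/2) − 3 = √3(t − t⋆)`, one more integrand-additivity move gives the stub:
`[(0,1), 3(t − t⁴)^(−3/4)] ~ [(0,1), √3(t + (1+√3)/2)(t − t⁴)^(−3/4)]`, together with the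
existence of the latter representation (a bounded algebraic factor times the former).

References: M. Kontsevich, D. Zagier, *Periods* (2001), §1.2 rules (1), (2).
-/

noncomputable section

open Set MeasureTheory MvPolynomial
open Literature.NumberTheory.Transcendental Literature.ModelTheory.ExponentialFields

namespace Summit.KontsevichZagierPeriods.TerasomaMultiplication.DasGapTwelve

open Summit.KontsevichZagierPeriods.HermiteRigidity.GenusTwoCycleTransfer (stub_pushforwardDimOne)
open Summit.KontsevichZagierPeriods.TerasomaMultiplication.DasGapTwelveNegative
  (measurableSet_unitIoo)

/-! ### The involution `m(t) = (1 − t)/(1 + 2t)`: elementary real analysis -/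

/-- `1 < √3 < 2`. [folklore] -/
theorem one_lt_sqrt_three : (1:ℝ) < Real.sqrt 3 ∧ Real.sqrt 3 < 2 := by
  constructor
  · rw [show (1:ℝ) = Real.sqrt 1 from Real.sqrt_one.symm]
    exact Real.sqrt_lt_sqrt (by norm_num) (by norm_num)
  · rw [show (2:ℝ) = Real.sqrt 4 by
      rw [show (4:ℝ) = 2 ^ 2 by norm_num, Real.sqrt_sq (by norm_num : (0:ℝ) ≤ 2)]]
    exact Real.sqrt_lt_sqrt (by norm_num) (by norm_num)

/-- The fixed point `t⋆ = (√3 − 1)/2` of the involution lies in `(0,1)`. [folklore] -/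
theorem tstar_mem_Ioo : (0:ℝ) < (Real.sqrt 3 - 1) / 2 ∧ (Real.sqrt 3 - 1) / 2 < 1 := by
  obtain ⟨h1, h2⟩ := one_lt_sqrt_three
  constructor <;> linarith

/-- `t⋆ = (√3 − 1)/2` is algebraic: a root of `2X² + 2X − 1`. [folklore] -/
theorem isAlgebraic_tstar : IsAlgebraic ℚ ((Real.sqrt 3 - 1) / 2) := by
  refine ⟨Polynomial.C 2 * Polynomial.X ^ 2 + Polynomial.C 2 * Polynomial.X - Polynomial.C 1,
    ?_, ?_⟩
  · intro h
    have h0 := congrArg (Polynomial.eval 0) h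
    simp at h0
  · simp only [map_sub, map_add, map_mul, map_pow, Polynomial.aeval_X, Polynomial.aeval_C,
      eq_ratCast]
    push_cast
    nlinarith [Real.sq_sqrt (show (0:ℝ) ≤ 3 by norm_num)]

/-- `m ∘ m = id` wherever `1 + 2t ≠ 0`. [folklore] -/
theorem mobius_mobius (t : ℝ) (h : (1:ℝ) + 2 * t ≠ 0) :
    (1 - (1 - t) / (1 + 2 * t)) / (1 + 2 * ((1 - t) / (1 + 2 * t))) = t := by
  have e1 : 1 - (1 - t) / (1 + 2 * t) = 3 * t / (1 + 2 * t) := by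
    rw [eq_div_iff h, sub_mul, div_mul_cancel₀ _ h]; ring
  have e2 : 1 + 2 * ((1 - t) / (1 + 2 * t)) = 3 / (1 + 2 * t) := by
    rw [eq_div_iff h, add_mul, mul_assoc, div_mul_cancel₀ _ h]; ring
  rw [e1, e2, div_div_div_cancel_right₀ h]
  ring

/-- `m` maps `(0, t⋆)` into `(t⋆, 1)`. [folklore] -/
theorem mobius_mem_of_mem_left {t : ℝ} (ht : t ∈ Ioo (0:ℝ) ((Real.sqrt 3 - 1) / 2)) :
    (1 - t) / (1 + 2 * t) ∈ Ioo ((Real.sqrt 3 - 1) / 2) 1 := by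
  obtain ⟨ht0, ht1⟩ := ht
  have hs : Real.sqrt 3 ^ 2 = 3 := Real.sq_sqrt (by norm_num)
  obtain ⟨hs1, hs2⟩ := one_lt_sqrt_three
  have h2t : 0 < 1 + 2 * t := by linarith
  refine ⟨?_, ?_⟩
  · rw [lt_div_iff₀ h2t]
    nlinarith [mul_lt_mul_of_pos_right ht1 (zero_lt_one.trans hs1)]
  · rw [div_lt_one h2t]
    linarith

/-- `m` maps `(t⋆, 1)` into `(0, t⋆)`. [folklore] -/
theorem mobius_mem_of_mem_right {u : ℝ} (hu : u ∈ Ioo ((Real.sqrt 3 - 1) / 2) 1) :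
    (1 - u) / (1 + 2 * u) ∈ Ioo (0:ℝ) ((Real.sqrt 3 - 1) / 2) := by
  obtain ⟨hu0, hu1⟩ := hu
  have hs : Real.sqrt 3 ^ 2 = 3 := Real.sq_sqrt (by norm_num)
  obtain ⟨hs1, hs2⟩ := one_lt_sqrt_three
  have h2u : 0 < 1 + 2 * u := by nlinarith
  refine ⟨div_pos (by linarith) h2u, ?_⟩
  rw [div_lt_iff₀ h2u]
  nlinarith [mul_lt_mul_of_pos_right hu0 (zero_lt_one.trans hs1)]

/-- The image of the cell `(0, t⋆) ⊂ ℝ¹` under `p ↦ (m (p 0))` is the cell `(t⋆, 1)` (explicit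
inverse: `m` itself). [folklore] -/
theorem image_mobius :
    (fun p : Fin 1 → ℝ => fun _ : Fin 1 => (1 - p 0) / (1 + 2 * p 0)) ''
        {x | x 0 ∈ Ioo (0:ℝ) ((Real.sqrt 3 - 1) / 2)} =
      {x | x 0 ∈ Ioo ((Real.sqrt 3 - 1) / 2) 1} := by
  ext q
  constructor
  · rintro ⟨p, hp, rfl⟩
    exact mobius_mem_of_mem_left hp
  · intro hq
    have hq0 : (0:ℝ) < q 0 := tstar_mem_Ioo.1.trans hq.1
    refine ⟨fun _ => (1 - q 0) / (1 + 2 * q 0), mobius_mem_of_mem_right hq, ?_⟩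
    funext i
    rw [Fin.fin_one_eq_zero i]
    exact mobius_mobius (q 0) (by linarith)

/-- `m′(t) = −3/(1+2t)²`. [folklore] -/
theorem hasDerivAt_mobius (t : ℝ) (h : (1:ℝ) + 2 * t ≠ 0) :
    HasDerivAt (fun y : ℝ => (1 - y) / (1 + 2 * y)) (-3 / (1 + 2 * t) ^ 2) t := by
  have h1 : HasDerivAt (fun y : ℝ => 1 - y) (-1) t := (hasDerivAt_id t).const_sub 1
  have h2 : HasDerivAt (fun y : ℝ => 1 + 2 * y) (2 * 1) t :=
    ((hasDerivAt_id t).const_mul 2).const_add 1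
  refine (h1.div h2 h).congr_deriv ?_
  field_simp
  ring

/-- **The fold identity** (anti-invariance of `κ = (t − t⋆)(t − t⁴)^(−3/4) dt` under `m`): for
`t ∈ (0,1)`, `√3(t − t⋆)(t − t⁴)^(−3/4) / |m′(t)| = −√3(m t − t⋆)(m t − (m t)⁴)^(−3/4)`; from
`m t − t⋆ = −√3(t − t⋆)/(1+2t)`, `m − m⁴ = (t − t⁴)(√3/(1+2t))⁴` and `(√3)³ = 3√3`. [folklore] -/
theorem fold_identity {t : ℝ} (ht : t ∈ Ioo (0:ℝ) 1) :
    Real.sqrt 3 * (t - (Real.sqrt 3 - 1) / 2) * (t - t ^ 4) ^ (-(3:ℝ)/4) / |-3 / (1 + 2 * t) ^ 2| =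
      -(Real.sqrt 3 * ((1 - t) / (1 + 2 * t) - (Real.sqrt 3 - 1) / 2) *
        ((1 - t) / (1 + 2 * t) - ((1 - t) / (1 + 2 * t)) ^ 4) ^ (-(3:ℝ)/4)) := by
  obtain ⟨ht0, ht1⟩ := ht
  have hs : Real.sqrt 3 ^ 2 = 3 := Real.sq_sqrt (by norm_num)
  have hs0 : 0 < Real.sqrt 3 := Real.sqrt_pos.mpr (by norm_num)
  have hs0' : Real.sqrt 3 ≠ 0 := hs0.ne'
  have h2t : 0 < 1 + 2 * t := by linarith
  have h2t' : 1 + 2 * t ≠ 0 := h2t.ne'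
  have hY : 0 < t - t ^ 4 := sub_pos.mpr (pow_lt_self_of_lt_one₀ ht0 ht1 (by norm_num))
  have hc0 : 0 < Real.sqrt 3 / (1 + 2 * t) := div_pos hs0 h2t
  have hu4 : (1 - t) / (1 + 2 * t) - ((1 - t) / (1 + 2 * t)) ^ 4 =
      (t - t ^ 4) * (Real.sqrt 3 / (1 + 2 * t)) ^ 4 := by
    rw [div_pow, div_pow, show Real.sqrt 3 ^ 4 = (Real.sqrt 3 ^ 2) ^ 2 by ring, hs,
      div_sub_div _ _ h2t' (pow_ne_zero 4 h2t'), mul_div_assoc', div_eq_div_iff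
        (mul_ne_zero h2t' (pow_ne_zero 4 h2t')) (pow_ne_zero 4 h2t')]
    ring
  have hut : (1 - t) / (1 + 2 * t) - (Real.sqrt 3 - 1) / 2 =
      -(Real.sqrt 3 / (1 + 2 * t) * (t - (Real.sqrt 3 - 1) / 2)) := by
    rw [div_sub_div _ _ h2t' two_ne_zero, div_mul_eq_mul_div, ← neg_div,
      div_eq_div_iff (mul_ne_zero h2t' two_ne_zero) h2t']
    linear_combination (-(1 + 2 * t)) * hs
  have hrpow : ((t - t ^ 4) * (Real.sqrt 3 / (1 + 2 * t)) ^ 4) ^ (-(3:ℝ)/4) =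
      (t - t ^ 4) ^ (-(3:ℝ)/4) * ((Real.sqrt 3 / (1 + 2 * t)) ^ 3)⁻¹ := by
    rw [Real.mul_rpow hY.le (pow_nonneg hc0.le 4),
      ← Real.rpow_natCast (Real.sqrt 3 / (1 + 2 * t)) 4, ← Real.rpow_mul hc0.le,
      show ((4:ℕ):ℝ) * (-(3:ℝ)/4) = -((3:ℕ):ℝ) by norm_num, Real.rpow_neg hc0.le,
      Real.rpow_natCast]
  have habs : |-3 / (1 + 2 * t) ^ 2| = 3 / (1 + 2 * t) ^ 2 := by
    rw [abs_div, abs_neg, abs_of_pos (by norm_num : (0:ℝ) < 3), abs_of_pos (pow_pos h2t 2)]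
  have hc3 : ((Real.sqrt 3 / (1 + 2 * t)) ^ 3)⁻¹ = (1 + 2 * t) ^ 3 / (3 * Real.sqrt 3) := by
    rw [div_pow, inv_div, pow_succ (Real.sqrt 3) 2, hs]
  rw [hu4, hut, hrpow, habs, hc3]
  field_simp

/-! ### Semialgebraicity -/

/-- A cell `{x | a < x 0 < b} ⊂ ℝ¹` with real-algebraic endpoints is `ℚ`-semialgebraic.
[cite: BochnakCosteRoy1998, §2.2] -/
theorem isSemialgebraic_cell {a b : ℝ} (ha : IsAlgebraic ℚ a) (hb : IsAlgebraic ℚ b) :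
    IsSemialgebraic ℚ {x : Fin 1 → ℝ | x 0 ∈ Ioo a b} :=
  (KZ.isSemialgebraic_setOf_const_lt_apply ha 0).inter (KZ.isSemialgebraic_setOf_apply_lt_const hb 0)

/-- `p ↦ m (p 0)` is `ℚ`-semialgebraic on any `ℚ`-semialgebraic `σ ⊆ ℝ¹` where `1 + 2 p₀ ≠ 0`
(a quotient of `ℚ`-polynomials). [cite: BochnakCosteRoy1998, §2.2] -/
theorem mobius_semialgebraic {σ : Set (Fin 1 → ℝ)} (hσ : IsSemialgebraic ℚ σ)
    (h : ∀ p ∈ σ, (1:ℝ) + 2 * p 0 ≠ 0) :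
    IsSemialgebraicFunOn ℚ σ (fun p => (1 - p 0) / (1 + 2 * p 0)) := by
  have h1 := isSemialgebraicFunOn_aeval_div_aeval hσ (1 - X 0 : MvPolynomial (Fin 1) ℚ)
    (1 + 2 * X 0) (fun p hp => by simpa using h p hp)
  exact h1.congr (fun p _ => by simp)

/-- `p ↦ m′ (p 0) = −3/(1 + 2 p₀)²` is `ℚ`-semialgebraic on any `ℚ`-semialgebraic `σ ⊆ ℝ¹` where
`1 + 2 p₀ ≠ 0`. [cite: BochnakCosteRoy1998, §2.2] -/
theorem mobius'_semialgebraic {σ : Set (Fin 1 → ℝ)} (hσ : IsSemialgebraic ℚ σ)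
    (h : ∀ p ∈ σ, (1:ℝ) + 2 * p 0 ≠ 0) :
    IsSemialgebraicFunOn ℚ σ (fun p => -3 / (1 + 2 * p 0) ^ 2) := by
  have h1 := isSemialgebraicFunOn_aeval_div_aeval hσ (-3 : MvPolynomial (Fin 1) ℚ)
    ((1 + 2 * X 0) ^ 2) (fun p hp => by simpa using h p hp)
  exact h1.congr (fun p _ => by simp)

/-! ### The moves -/

/-- **Rule 2 along the involution.** A representation `K₁` on the cell `(0, t⋆)` pushes forward
along `m` to a representation `s` on the cell `(t⋆, 1)` with `s(m t) = K₁(t)/|m′(t)|` and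
`[K₁] − [s] ∈ KZ.changeOfVariablesRel` (`stub_pushforwardDimOne` with `φ = G = m`, `m ∘ m = id`).
[cite: KontsevichZagier2001, §1.2 rule (2)] -/
theorem fold_pushforward (K₁ : KZ.IntegralRep 1)
    (hK₁ : K₁.domain = {x | x 0 ∈ Ioo (0:ℝ) ((Real.sqrt 3 - 1) / 2)}) :
    ∃ s : KZ.IntegralRep 1, s.domain = {x | x 0 ∈ Ioo ((Real.sqrt 3 - 1) / 2) 1} ∧
      (∀ p ∈ K₁.domain, s.integrand (fun _ => (1 - p 0) / (1 + 2 * p 0)) =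
        K₁.integrand p / |-3 / (1 + 2 * p 0) ^ 2|) ∧
      KZ.of K₁ - KZ.of s ∈ KZ.changeOfVariablesRel := by
  obtain ⟨hτ0, _⟩ := tstar_mem_Ioo
  have hC₂s : IsSemialgebraic ℚ {x : Fin 1 → ℝ | x 0 ∈ Ioo ((Real.sqrt 3 - 1) / 2) 1} :=
    isSemialgebraic_cell isAlgebraic_tstar isAlgebraic_one
  have h2t : ∀ p ∈ K₁.domain, (1:ℝ) + 2 * p 0 ≠ 0 := fun p hp => by
    rw [hK₁] at hp
    exact ne_of_gt (by linarith [hp.1])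
  have h2t' : ∀ p ∈ {x : Fin 1 → ℝ | x 0 ∈ Ioo ((Real.sqrt 3 - 1) / 2) 1}, (1:ℝ) + 2 * p 0 ≠ 0 :=
    fun p hp => ne_of_gt (by linarith [hτ0.trans hp.1])
  have hG : IsSemialgebraicMapOn ℚ
      ((fun p : Fin 1 → ℝ => fun _ : Fin 1 => (1 - p 0) / (1 + 2 * p 0)) '' K₁.domain)
      (fun (q : Fin 1 → ℝ) (_ : Fin 1) => (1 - q 0) / (1 + 2 * q 0)) := by
    rw [hK₁, image_mobius]
    exact IsSemialgebraicMapOn.of_forall hC₂s fun _ => mobius_semialgebraic hC₂s h2t'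
  obtain ⟨s, hsd, hsi, hrel⟩ := stub_pushforwardDimOne K₁ (fun y => (1 - y) / (1 + 2 * y))
    (fun y => -3 / (1 + 2 * y) ^ 2) (fun q _ => (1 - q 0) / (1 + 2 * q 0))
    (mobius_semialgebraic K₁.isSemialgebraic_domain h2t)
    (mobius'_semialgebraic K₁.isSemialgebraic_domain h2t)
    (fun p hp => hasDerivAt_mobius (p 0) (h2t p hp))
    (fun p hp => div_ne_zero (by norm_num) (pow_ne_zero 2 (h2t p hp))) hG
    (fun p hp => funext fun i => by rw [Fin.fin_one_eq_zero i]; exact mobius_mobius (p 0) (h2t p hp))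
  exact ⟨s, hsd.trans (by rw [hK₁, image_mobius]), hsi, hrel⟩

/-- **The fold.** A representation on `(0,1)` with integrand `√3(t − t⋆)(t − t⁴)^(−3/4)` is a
relation: split at `t⋆` (rule 1a; `{t⋆}` is null), push the left cell forward along `m` (rule 2),
and cancel against the right cell by the fold identity (rule 1b).
[cite: KontsevichZagier2001, §1.2 rules (1), (2)] -/
theorem of_mem_relations_of_fold (K : KZ.IntegralRep 1) (hKd : K.domain = {x | x 0 ∈ Ioo (0:ℝ) 1})
    (hKi : EqOn K.integrand
      (fun x => Real.sqrt 3 * (x 0 - (Real.sqrt 3 - 1) / 2) * (x 0 - x 0 ^ 4) ^ (-(3:ℝ)/4))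
      K.domain) :
    KZ.of K ∈ KZ.relations := by
  obtain ⟨hτ0, hτ1⟩ := tstar_mem_Ioo
  have hC₁s : IsSemialgebraic ℚ {x : Fin 1 → ℝ | x 0 ∈ Ioo (0:ℝ) ((Real.sqrt 3 - 1) / 2)} :=
    isSemialgebraic_cell isAlgebraic_zero isAlgebraic_tstar
  have hC₂s : IsSemialgebraic ℚ {x : Fin 1 → ℝ | x 0 ∈ Ioo ((Real.sqrt 3 - 1) / 2) 1} :=
    isSemialgebraic_cell isAlgebraic_tstar isAlgebraic_one
  have hC₁K : {x : Fin 1 → ℝ | x 0 ∈ Ioo (0:ℝ) ((Real.sqrt 3 - 1) / 2)} ⊆ K.domain :=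
    fun x hx => by rw [hKd]; exact ⟨hx.1, hx.2.trans hτ1⟩
  have hC₂K : {x : Fin 1 → ℝ | x 0 ∈ Ioo ((Real.sqrt 3 - 1) / 2) 1} ⊆ K.domain :=
    fun x hx => by rw [hKd]; exact ⟨hτ0.trans hx.1, hx.2⟩
  set K₁ := K.restrict _ hC₁s hC₁K with hK₁
  set K₂ := K.restrict _ hC₂s hC₂K with hK₂
  -- rule 1a: `[K] − [K₁] − [K₂]` is a relation (the uncovered point `t⋆` is null)
  have hsplit : KZ.of K - KZ.of K₁ - KZ.of K₂ ∈ KZ.relations := by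
    have hU := hC₁s.union hC₂s
    have hUK := union_subset hC₁K hC₂K
    have hvol : volume (K.domain \ ({x : Fin 1 → ℝ | x 0 ∈ Ioo (0:ℝ) ((Real.sqrt 3 - 1) / 2)} ∪
        {x : Fin 1 → ℝ | x 0 ∈ Ioo ((Real.sqrt 3 - 1) / 2) 1})) = 0 := by
      refine measure_mono_null (fun x hx => ?_)
        (KZ.volume_setOf_last_eq_zero (n := 0) ((Real.sqrt 3 - 1) / 2))
      rw [hKd] at hx
      obtain ⟨⟨hx0, hx1⟩, hxU⟩ := hx
      rcases lt_trichotomy (x 0) ((Real.sqrt 3 - 1) / 2) with h | h | h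
      · exact absurd (Or.inl ⟨hx0, h⟩) hxU
      · exact h
      · exact absurd (Or.inr ⟨h, hx1⟩) hxU
    have h1 := K.of_sub_of_restrict_mem_relations hU hUK hvol
    have h2 : KZ.of (K.restrict _ hU hUK) - KZ.of K₁ - KZ.of K₂ ∈ KZ.domainAddRel := by
      refine ⟨1, K.restrict _ hU hUK, K₁, K₂, rfl, ?_, fun _ _ => rfl, fun _ _ => rfl, rfl⟩
      rw [show K₁.domain ∩ K₂.domain = ∅ from
        eq_empty_of_forall_notMem fun x hx => lt_irrefl _ (hx.1.2.trans hx.2.1), measure_empty]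
    have : KZ.of K - KZ.of K₁ - KZ.of K₂ = (KZ.of K - KZ.of (K.restrict _ hU hUK)) +
        (KZ.of (K.restrict _ hU hUK) - KZ.of K₁ - KZ.of K₂) := by abel
    rw [this]
    exact KZ.relations.add_mem h1 (KZ.domainAddRel_subset_relations h2)
  -- rule 2: push `K₁` forward along the involution
  obtain ⟨s, hsd, hsi, hrel⟩ := fold_pushforward K₁ rfl
  -- rule 1b: `[K₂] + [s]` is a relation (the fold identity)
  have hcancel : KZ.of K₂ + KZ.of s ∈ KZ.relations := by
    refine KZ.of_add_of_mem_relations_of_eqOn_neg (r := K₂) (r' := s) hsd (fun q hq => ?_)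
    have hq' : q ∈ (fun p : Fin 1 → ℝ => fun _ : Fin 1 => (1 - p 0) / (1 + 2 * p 0)) ''
        {x : Fin 1 → ℝ | x 0 ∈ Ioo (0:ℝ) ((Real.sqrt 3 - 1) / 2)} := by
      rw [image_mobius]; exact hq
    obtain ⟨p, hp, rfl⟩ := hq'
    rw [Pi.neg_apply, hsi p hp]
    have e1 : K₁.integrand p = _ := hKi (hC₁K hp)
    have e2 : K₂.integrand (fun _ => (1 - p 0) / (1 + 2 * p 0)) = _ := hKi (hC₂K hq)
    rw [e1, e2]
    exact fold_identity ⟨hp.1, hp.2.trans hτ1⟩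
  have : KZ.of K = (KZ.of K - KZ.of K₁ - KZ.of K₂) + (KZ.of K₁ - KZ.of s) +
      (KZ.of K₂ + KZ.of s) := by abel
  rw [this]
  exact KZ.relations.add_mem (KZ.relations.add_mem hsplit
    (KZ.changeOfVariablesRel_subset_relations hrel)) hcancel

/-! ### The stub -/

/-- Existence of the folded representation `[(0,1), √3(t + (1+√3)/2)(t − t⁴)^(−3/4)]`: its
integrand is the bounded `ℚ`-semialgebraic factor `(√3/3)(t + (1+√3)/2)` times that of the given
representation `[(0,1), 3(t − t⁴)^(−3/4)]`. [cite: KontsevichZagier2001, §1.1] -/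
theorem exists_rho₂ (ρ₁ : KZ.IntegralRep 1) (hd₁ : ρ₁.domain = {x | x 0 ∈ Ioo (0:ℝ) 1})
    (hi₁ : EqOn ρ₁.integrand (fun x => 3 * (x 0 - x 0 ^ 4) ^ (-(3:ℝ)/4)) ρ₁.domain) :
    ∃ ρ₂ : KZ.IntegralRep 1, ρ₂.domain = {x | x 0 ∈ Ioo (0:ℝ) 1} ∧ EqOn ρ₂.integrand
      (fun x => Real.sqrt 3 * (x 0 + (1 + Real.sqrt 3) / 2) * (x 0 - x 0 ^ 4) ^ (-(3:ℝ)/4))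
      ρ₂.domain := by
  have hU : IsSemialgebraic ℚ {x : Fin 1 → ℝ | x 0 ∈ Ioo (0:ℝ) 1} :=
    hd₁ ▸ ρ₁.isSemialgebraic_domain
  have hsa₁ : IsSemialgebraicFunOn ℚ {x : Fin 1 → ℝ | x 0 ∈ Ioo (0:ℝ) 1} ρ₁.integrand :=
    hd₁ ▸ ρ₁.isSemialgebraicFunOn_integrand
  have hint₁ : IntegrableOn ρ₁.integrand {x : Fin 1 → ℝ | x 0 ∈ Ioo (0:ℝ) 1} :=
    hd₁ ▸ ρ₁.integrableOn
  obtain ⟨hs1, hs2⟩ := one_lt_sqrt_three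
  -- the bounded algebraic factor
  have hb : IsSemialgebraicFunOn ℚ {x : Fin 1 → ℝ | x 0 ∈ Ioo (0:ℝ) 1}
      (fun x => Real.sqrt 3 / 3 * (x 0 + (1 + Real.sqrt 3) / 2)) := by
    have h3 := isSemialgebraicFunOn_const_ofNat hU 3
    have h2 := isSemialgebraicFunOn_const_ofNat hU 2
    have h1 : IsSemialgebraicFunOn ℚ {x : Fin 1 → ℝ | x 0 ∈ Ioo (0:ℝ) 1} (fun _ => (1:ℝ)) :=
      (isSemialgebraicFunOn_const_natCast hU 1).congr fun _ _ => Nat.cast_one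
    have hs := h3.fun_sqrt
    have hx : IsSemialgebraicFunOn ℚ {x : Fin 1 → ℝ | x 0 ∈ Ioo (0:ℝ) 1} (fun x => x 0) :=
      (isSemialgebraicFunOn_aeval hU (X 0)).congr fun x _ => by simp
    exact (hs.div h3 fun _ _ => three_ne_zero).fun_mul
      (hx.fun_add ((h1.fun_add hs).div h2 fun _ _ => two_ne_zero))
  have heq : EqOn (fun x => Real.sqrt 3 / 3 * (x 0 + (1 + Real.sqrt 3) / 2) * ρ₁.integrand x)
      (fun x => Real.sqrt 3 * (x 0 + (1 + Real.sqrt 3) / 2) * (x 0 - x 0 ^ 4) ^ (-(3:ℝ)/4))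
      {x : Fin 1 → ℝ | x 0 ∈ Ioo (0:ℝ) 1} := by
    intro x hx
    simp only
    rw [hi₁ (by rw [hd₁]; exact hx)]
    ring
  refine ⟨⟨_, _, hU, (hb.fun_mul hsa₁).congr heq, ?_⟩, rfl, fun _ _ => rfl⟩
  refine IntegrableOn.congr_fun ?_ heq measurableSet_unitIoo
  refine Integrable.bdd_mul (c := 2) hint₁ (Continuous.aestronglyMeasurable (by fun_prop)) ?_
  refine ae_restrict_of_forall_mem measurableSet_unitIoo fun x hx => ?_
  obtain ⟨hx0, hx1⟩ := hx
  rw [Real.norm_eq_abs, abs_of_pos (by positivity)]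
  nlinarith [mul_le_mul hs2.le hx1.le hx0.le zero_le_two]

/-- **Stub F (`stub_involutionFold`)**, the fold by the real involution `t ↦ (1−t)/(1+2t)` of
`v⁴ = t − t⁴`: since `√3(t + (1+√3)/2) − 3 = √3(t − t⋆)` with `t⋆ = (√3−1)/2` and
`[(0,1), √3(t − t⋆)(t−t⁴)^(−3/4)]` is a relation (`of_mem_relations_of_fold`), the representation
`[(0,1), 3(t−t⁴)^(−3/4)]` is equivalent to every representation
`[(0,1), √3(t + (1+√3)/2)(t−t⁴)^(−3/4)]` (one integrand-additivity move), and such a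
representation exists (`exists_rho₂`). [cite: KontsevichZagier2001, §1.2 rules (1), (2)] -/
theorem stub_involutionFold :
    ∀ (ρ₁ : Literature.NumberTheory.Transcendental.KZ.IntegralRep 1), ρ₁.domain = {x | x 0 ∈ Set.Ioo (0:ℝ) 1} → Set.EqOn ρ₁.integrand (fun x => 3 * (x 0 - (x 0) ^ 4) ^ (-(3:ℝ)/4)) ρ₁.domain → (∃ ρ₂ : Literature.NumberTheory.Transcendental.KZ.IntegralRep 1, ρ₂.domain = {x | x 0 ∈ Set.Ioo (0:ℝ) 1} ∧ Set.EqOn ρ₂.integrand (fun x => Real.sqrt 3 * (x 0 + (1 + Real.sqrt 3) / 2) * (x 0 - (x 0) ^ 4) ^ (-(3:ℝ)/4)) ρ₂.domain) ∧ ∀ (ρ₂ : Literature.NumberTheory.Transcendental.KZ.IntegralRep 1), ρ₂.domain = {x | x 0 ∈ Set.Ioo (0:ℝ) 1} → Set.EqOn ρ₂.integrand (fun x => Real.sqrt 3 * (x 0 + (1 + Real.sqrt 3) / 2) * (x 0 - (x 0) ^ 4) ^ (-(3:ℝ)/4)) ρ₂.domain → Literature.NumberTheory.Transcendental.KZ.Equivalent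 ρ₁ ρ₂ := by
  intro ρ₁ hd₁ hi₁
  refine ⟨exists_rho₂ ρ₁ hd₁ hi₁, fun ρ₂ hd₂ hi₂ => ?_⟩
  have hd : ρ₁.domain = ρ₂.domain := by rw [hd₁, hd₂]
  have hsa₂ : IsSemialgebraicFunOn ℚ ρ₁.domain ρ₂.integrand :=
    hd ▸ ρ₂.isSemialgebraicFunOn_integrand
  have hint₂ : IntegrableOn ρ₂.integrand ρ₁.domain := hd ▸ ρ₂.integrableOn
  -- the difference representation `K = [(0,1), ρ₂ − ρ₁]`
  refine (fun (K : KZ.IntegralRep 1) (hKd : K.domain = ρ₁.domain)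
    (hKi : ∀ x, K.integrand x = ρ₂.integrand x - ρ₁.integrand x) => ?_)
    ⟨ρ₁.domain, fun x => ρ₂.integrand x - ρ₁.integrand x, ρ₁.isSemialgebraic_domain,
      hsa₂.fun_sub ρ₁.isSemialgebraicFunOn_integrand, hint₂.sub ρ₁.integrableOn⟩ rfl fun _ => rfl
  -- rule 1b: `[ρ₂] − [ρ₁] − [K]` is a relation
  have hadd : KZ.of ρ₂ - KZ.of ρ₁ - KZ.of K ∈ KZ.integrandAddRel :=
    ⟨1, ρ₂, ρ₁, K, hd, hKd.trans hd, fun x _ => by rw [Pi.add_apply, hKi]; ring, rfl⟩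
  -- `K` is the fold: its integrand is `√3(t − t⋆)(t − t⁴)^(−3/4)` on `(0,1)`
  have hs : Real.sqrt 3 ^ 2 = 3 := Real.sq_sqrt (by norm_num)
  have hK : KZ.of K ∈ KZ.relations := by
    refine of_mem_relations_of_fold K (hKd.trans hd₁) fun x hx => ?_
    rw [hKd] at hx
    rw [hKi, hi₁ hx, hi₂ (hd ▸ hx)]
    linear_combination ((x 0 - x 0 ^ 4) ^ (-(3:ℝ)/4)) * hs
  show KZ.of ρ₁ - KZ.of ρ₂ ∈ KZ.relations
  have : KZ.of ρ₁ - KZ.of ρ₂ = -(KZ.of ρ₂ - KZ.of ρ₁ - KZ.of K) - KZ.of K := by abel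
  rw [this]
  exact KZ.relations.sub_mem (KZ.relations.neg_mem (KZ.integrandAddRel_subset_relations hadd)) hK

end Summit.KontsevichZagierPeriods.TerasomaMultiplication.DasGapTwelve

end
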